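import Mathlib
import Summits.AnomalousDissipation.AnomalousDissipation.Theorems.SoloBlindResolventReadout

/-!
# Solo-blind kernel #282 — Neumann series to second order with explicit remainders

The algebra of the EXPANSION-AT-INFINITY lemma for the outer region (ENGINE-L-SPEC §15(o.3)):
in a complete normed ring with `‖1‖ = 1`, for `‖T‖ ≤ q < 1`,
* `inverse_one_sub_eq_first` / `_second`: `(1−T)⁻¹ = 1 + T(1−T)⁻¹ = 1 + T + T²(1−T)⁻¹` (exact);
* `norm_inverse_one_sub_sub_one_le`: `‖(1−T)⁻¹ − 1‖ ≤ q/(1−q)`;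
  `norm_inverse_one_sub_sub_le`: `‖(1−T)⁻¹ − 1 − T‖ ≤ q²/(1−q)`;
* `inverse_add_expansion`: for a unit `D` and `T := D⁻¹K` with `‖T‖ ≤ q < 1`, `D + K` is a unit and
  `‖(D+K)⁻¹ − (D⁻¹ − D⁻¹KD⁻¹)‖ ≤ q²/(1−q) · ‖D⁻¹‖` — the second-order expansion of the chain Green's
  function `G̃ = (D+K)⁻¹` about the diagonal, whose first two terms carry the `1/x` and `1/x²` behaviour
  of `k̂_y/c` at `x → ∞` and whose remainder is `O(1/δ³)`·‖K‖².
-/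

namespace Summit.AnomalousDissipation.SoloBlind.NeumannSecondOrder

open Summit.AnomalousDissipation.SoloBlind.ResolventReadout

variable {A : Type*} [NormedRing A] [CompleteSpace A] [NormOneClass A]

omit [CompleteSpace A] [NormOneClass A] in
/-- `(1−T)⁻¹ = 1 + T (1−T)⁻¹` when `1 − T` is a unit. -/
theorem inverse_one_sub_eq_first {T : A} (h : IsUnit (1 - T)) :
    Ring.inverse (1 - T) = 1 + T * Ring.inverse (1 - T) := by
  have h1 : (1 - T) * Ring.inverse (1 - T) = 1 := Ring.mul_inverse_cancel _ h
  have h2 : Ring.inverse (1 - T) = 1 + T * Ring.inverse (1 - T) := by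
    have : (1 - T) * Ring.inverse (1 - T) = Ring.inverse (1 - T) - T * Ring.inverse (1 - T) := by
      rw [sub_mul, one_mul]
    rw [this] at h1
    exact (sub_eq_iff_eq_add.1 h1)
  exact h2

omit [CompleteSpace A] [NormOneClass A] in
/-- `(1−T)⁻¹ = 1 + T + T² (1−T)⁻¹` when `1 − T` is a unit. -/
theorem inverse_one_sub_eq_second {T : A} (h : IsUnit (1 - T)) :
    Ring.inverse (1 - T) = 1 + T + T * T * Ring.inverse (1 - T) := by
  have h1 := inverse_one_sub_eq_first h
  conv_lhs => rw [h1]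
  conv_lhs => arg 2; rw [h1]
  rw [mul_add, mul_one, ← mul_assoc, add_assoc]

/-- **First-order remainder**: `‖(1−T)⁻¹ − 1‖ ≤ q/(1−q)`. -/
theorem norm_inverse_one_sub_sub_one_le {T : A} {q : ℝ} (hT : ‖T‖ ≤ q) (hq : q < 1) :
    ‖Ring.inverse (1 - T) - 1‖ ≤ q / (1 - q) := by
  have hu : IsUnit (1 - T) := isUnit_of_norm_lt_one (lt_of_le_of_lt hT hq)
  have hR := norm_inverse_one_sub_le hT hq
  have hq0 : 0 ≤ q := le_trans (norm_nonneg _) hT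
  have h1q : 0 < 1 - q := by linarith
  rw [inverse_one_sub_eq_first hu, add_sub_cancel_left]
  calc ‖T * Ring.inverse (1 - T)‖ ≤ ‖T‖ * ‖Ring.inverse (1 - T)‖ := norm_mul_le _ _
    _ ≤ q * (1 - q)⁻¹ := mul_le_mul hT hR (norm_nonneg _) hq0
    _ = q / (1 - q) := by rw [div_eq_mul_inv]

/-- **Second-order remainder**: `‖(1−T)⁻¹ − 1 − T‖ ≤ q²/(1−q)`. -/
theorem norm_inverse_one_sub_sub_le {T : A} {q : ℝ} (hT : ‖T‖ ≤ q) (hq : q < 1) :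
    ‖Ring.inverse (1 - T) - 1 - T‖ ≤ q ^ 2 / (1 - q) := by
  have hu : IsUnit (1 - T) := isUnit_of_norm_lt_one (lt_of_le_of_lt hT hq)
  have hR := norm_inverse_one_sub_le hT hq
  have hq0 : 0 ≤ q := le_trans (norm_nonneg _) hT
  have h1q : 0 < 1 - q := by linarith
  have he : Ring.inverse (1 - T) - 1 - T = T * T * Ring.inverse (1 - T) := by
    conv_lhs => rw [inverse_one_sub_eq_second hu]
    abel
  rw [he]
  calc ‖T * T * Ring.inverse (1 - T)‖ ≤ ‖T‖ * ‖T‖ * ‖Ring.inverse (1 - T)‖ :=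
        le_trans (norm_mul_le _ _) (mul_le_mul_of_nonneg_right (norm_mul_le _ _) (norm_nonneg _))
    _ ≤ q * q * (1 - q)⁻¹ := by
        apply mul_le_mul (mul_le_mul hT hT (norm_nonneg _) hq0) hR (norm_nonneg _)
          (mul_nonneg hq0 hq0)
    _ = q ^ 2 / (1 - q) := by rw [div_eq_mul_inv, sq]

/-- **Second-order expansion of `(D + K)⁻¹` about an invertible `D`.**  With `T := −D⁻¹K`
(`‖D⁻¹K‖ ≤ q < 1`): `D + K = D(1 − T)` is a unit and
`‖(D+K)⁻¹ − (D⁻¹ − D⁻¹ K D⁻¹)‖ ≤ q²/(1−q) · ‖D⁻¹‖`. -/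
theorem inverse_add_expansion {D K : A} (hD : IsUnit D) {q : ℝ}
    (hT : ‖Ring.inverse D * K‖ ≤ q) (hq : q < 1) :
    IsUnit (D + K) ∧
      ‖Ring.inverse (D + K) - (Ring.inverse D - Ring.inverse D * K * Ring.inverse D)‖
        ≤ q ^ 2 / (1 - q) * ‖Ring.inverse D‖ := by
  obtain ⟨u, rfl⟩ := hD
  set Di : A := Ring.inverse (↑u : A) with hDi
  have hDi' : Di = ↑u⁻¹ := by rw [hDi, Ring.inverse_unit]
  set T : A := -(Di * K) with hTdef
  have hTn : ‖T‖ ≤ q := by rw [hTdef, norm_neg]; exact hT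
  have hu1 : IsUnit (1 - T) := isUnit_of_norm_lt_one (lt_of_le_of_lt hTn hq)
  -- D + K = D (1 - T)
  have hfac : (↑u : A) + K = ↑u * (1 - T) := by
    rw [hTdef, sub_neg_eq_add, mul_add, mul_one, ← mul_assoc, hDi', Units.mul_inv, one_mul]
  obtain ⟨w, hw⟩ := hu1
  have hunit : IsUnit ((↑u : A) + K) := by rw [hfac, ← hw]; exact (u * w).isUnit
  refine ⟨hunit, ?_⟩
  -- inverse of the product
  have hinv : Ring.inverse ((↑u : A) + K) = Ring.inverse (1 - T) * Di := by
    rw [hfac, ← hw, show (↑u : A) * ↑w = ↑(u * w) from rfl, Ring.inverse_unit, mul_inv_rev,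
      Units.val_mul, hDi', Ring.inverse_unit]
  -- expansion: (1-T)⁻¹ Di - (Di - Di K Di) = ((1-T)⁻¹ - 1 - T) Di
  have hexp : Ring.inverse ((↑u : A) + K) - (Di - Di * K * Di)
      = (Ring.inverse (1 - T) - 1 - T) * Di := by
    rw [hinv, hTdef, sub_mul, sub_mul, one_mul, neg_mul, sub_neg_eq_add, mul_assoc]
    abel
  rw [hexp]
  calc ‖(Ring.inverse (1 - T) - 1 - T) * Di‖ ≤ ‖Ring.inverse (1 - T) - 1 - T‖ * ‖Di‖ := norm_mul_le _ _
    _ ≤ q ^ 2 / (1 - q) * ‖Di‖ :=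
        mul_le_mul_of_nonneg_right (norm_inverse_one_sub_sub_le hTn hq) (norm_nonneg _)

end Summit.AnomalousDissipation.SoloBlind.NeumannSecondOrder
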